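import Mathlib
import Summits.Ventures.PercRepro2.StarOAlgebra

/-!
# The κ-table of class O (blind cell PercRepro2, night-1 g8; NIGHT1-G8.md §9)

The attachment coefficient `κ = 4 HMFc(p[f ↦ ½]) − 2 HMFc(p[f ↦ 1])` of a leaf `a₃` pendant at a
vertex `u` adjacent only to `a₁`, `a₂`, `o` (`HMFLeafRB.kappa_eq`) is, after the transport to the
loop graph, the polynomial `kappaMassO` of the class-O table at `u`: the four individual `Q`-masses
`P(Q, o ∈ C(a₁))`, `P(Q, o ∈ C(a₂))`, `P(Q, b ∈ C(a₂))`, `P(Q, b ∈ C(a₁))` (whose differences are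
`eqoMass` and `gapMass` of `StarOAlgebra`) and the masses `zMass, dMass, doMass, wMass, xhatMass,
eq3Mass, eq3oMass` already in `StarOAlgebra`.
-/

namespace Summit.Ventures.PercRepro2

namespace StarO

variable {R : Type*} [CommRing R]

/-- `A_L = P(Q, o ∈ C(a₁)) = αβ̄(A_L + rA_N) + ᾱA_L(1 − βr)`. -/
def qoLMass (Z1 AL AH al be r : R) : R :=
  al * (1 - be) * (AL + r * (Z1 - AL - AH)) + (1 - al) * AL * (1 - be * r)

/-- `A_H = P(Q, o ∈ C(a₂)) = βᾱ(A_H + rA_N) + β̄A_H(1 − αr)`. -/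
def qoHMass (Z1 AL AH al be r : R) : R :=
  be * (1 - al) * (AH + r * (Z1 - AL - AH)) + (1 - be) * AH * (1 - al * r)

/-- `B_H = P(Q, b ∈ C(a₂)) = ᾱβ̄B_H + αβ̄(B_H − rP_HH) + βᾱ(B_H − rP_LH + r·cob)`. -/
def qbHMass (BH PLH PHH cob al be r : R) : R :=
  (1 - al) * (1 - be) * BH + al * (1 - be) * (BH - r * PHH) +
    be * (1 - al) * (BH - r * PLH + r * cob)

/-- `B_L = P(Q, b ∈ C(a₁)) = ᾱβ̄B_L + βᾱ(B_L − rP_LL) + αβ̄(B_L − rP_HL + r·cob)`. -/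
def qbLMass (BL PLL PHL cob al be r : R) : R :=
  (1 - al) * (1 - be) * BL + be * (1 - al) * (BL - r * PLL) +
    al * (1 - be) * (BL - r * PHL + r * cob)

/-- **The attachment coefficient of a leaf at the class-O vertex** in the table
(`HMFLeafRB.kappa_eq` with every mass replaced by its class-O expression):
`κ = 2Z(A_L + A_H − D_o)(W − B_H) + 2(Z − D)(A_L B_H + A_H B_L − Z X̂) +
(B_H − B_L)((A_L + A_H − D_o) E_Q[σ₃] − (Z − D) E_Q[σ₃ 1_{o∈U}])`. -/
def kappaMassO (Z1 AL AH BL BH PLH PLL PHL PHH PNH cob Gob Gpob X0 al be r : R) : R :=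
  2 * zMass Z1 AL AH al be r *
      (qoLMass Z1 AL AH al be r + qoHMass Z1 AL AH al be r - doMass AL AH al be r) *
      (wMass BL BH PLH PLL PHL PHH PNH cob al be r - qbHMass BH PLH PHH cob al be r) +
    2 * (zMass Z1 AL AH al be r - dMass Z1 AL AH al be r) *
      (qoLMass Z1 AL AH al be r * qbHMass BH PLH PHH cob al be r +
        qoHMass Z1 AL AH al be r * qbLMass BL PLL PHL cob al be r -
        zMass Z1 AL AH al be r * xhatMass PLH PHL Gob Gpob X0 al be r) +
    (qbHMass BH PLH PHH cob al be r - qbLMass BL PLL PHL cob al be r) *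
      ((qoLMass Z1 AL AH al be r + qoHMass Z1 AL AH al be r - doMass AL AH al be r) *
          eq3Mass Z1 AL AH al be r -
        (zMass Z1 AL AH al be r - dMass Z1 AL AH al be r) * eq3oMass Z1 AL AH al be r)

end StarO

end Summit.Ventures.PercRepro2
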